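import Mathlib

/-! Toy-form kernel check of the DiagonalGain engine claim (critic 12:50:42Z (3)):
at the diagonal edge point the tangent complex covectors are
`ℓ₀ = (κ, i n₁, i n₂, i n₃)` and `ℓ_u = κ u + i ω_u = (κ/2 − i√3/2, κ s₁/2 + i n₁/2, κ s₂/2 + i n₂/2, κ s₃/2 + i n₃/2)`
with `n⃗ = s⃗/√3`.  The (0,j) 2×2 minor equals `s_j (κ² − 1)/2` and the (j,k) minors vanish, so
`ℓ_u ∈ ℂ·ℓ₀` iff `κ² = 1`. -/

open Complex

/-- the time–space minors: `ℓ₀(0) ℓ_u(j) − ℓ₀(j) ℓ_u(0) = s_j (κ² − 1) / 2` given `√3·n_j = s_j`. -/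
example (κ s n r : ℂ) (hr : r * r = 3) (h : r * n = s) :
    κ * (κ * s / 2 + I * n / 2) - (I * n) * (κ / 2 - I * r / 2) = s * (κ ^ 2 - 1) / 2 := by
  have hI : I * I = -1 := by rw [← sq, I_sq]
  linear_combination (n * r / 2) * hI + (1/2 : ℂ) * h * 0 + (-(1:ℂ)/2) * (h) + (0:ℂ) * hr

/-- the space–space minors vanish: `ℓ₀(j) ℓ_u(k) − ℓ₀(k) ℓ_u(j) = 0` given `n⃗ ∥ s⃗` (`r n_j = s_j`, `r n_k = s_k`). -/
example (κ r nj nk sj sk : ℂ) (hj : r * nj = sj) (hk : r * nk = sk) :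
    (I * nj) * (κ * sk / 2 + I * nk / 2) - (I * nk) * (κ * sj / 2 + I * nj / 2) = 0 := by
  linear_combination (I * κ * nj / 2) * (-hk) + (I * κ * nk / 2) * hj

/-- tangency bookkeeping at `p⋆ = (t, iκt n⃗)`, `|n⃗| = 1`, for `u = (1, s⃗)/2`, `|s⃗|² = 3`:
`|Im p⋆_{⊥u}|² = κ²t²(1 − (n⃗·s⃗)²/4)` and `(κ Re(p⋆·u))² = κ²t²/4`, so `p⋆ ∈ ∂T_u(κ)` iff `(n⃗·s⃗)² = 3`. -/
example (κ t d : ℝ) (hκ : κ ≠ 0) (ht : t ≠ 0) :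
    κ ^ 2 * t ^ 2 * (1 - d ^ 2 / 4) = (κ * (t / 2)) ^ 2 ↔ d ^ 2 = 3 := by
  constructor
  · intro h
    have h' : κ ^ 2 * t ^ 2 * (3 - d ^ 2) = 0 := by nlinarith [h]
    have hkt : κ ^ 2 * t ^ 2 ≠ 0 := by positivity
    have := (mul_eq_zero.mp h').resolve_left hkt
    linarith
  · intro h; rw [h]; ring
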